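import Mathlib
import Summits.Ventures.PercRepro2.ZMeanProof
import Summits.Ventures.PercRepro2.PendantRoot
import Summits.Ventures.PercRepro2.HMFLeaf
import Summits.Ventures.PercRepro2.HMFPendantRoot
import Summits.Ventures.PercRepro2.HMFTwoRootStar

/-!
# The two-root star at `a₃`: masses, the split of `X̂`, the heavy and light rows
(blind cell PercRepro2, night-1 g6; exploration lens, NIGHT1-G6.md §7)

For a star-free event `A` the four edge states factor (`prob_inter_cc` … `prob_inter_nb`).
Exploring `C(a₃)` splits the mean-field sum (`Xhat_star`): the `{a₃}` row (mass `(1−α)(1−β)`), the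
heavy rows (`f₁` closed, `f₂` open: `C(a₃) = C(a₂)`), the light rows (`f₁` open, `f₂` closed:
`C(a₃) = C(a₁)`); the both-open rows carry no weight (`sum_oo_eq_zero`).  The heavy (light) rows are
the pendant-root rows of `HMFPendantRoot.lean` for the pinned law `p[f₁ ↦ 0][f₂ ↦ 1]`
(`p[f₂ ↦ 0][f₁ ↦ 1]`): `heavy_sum_star`, `light_sum_star`.
-/

namespace Summit.Ventures.PercRepro2

open UnionCluster CovForm PendantRoot

namespace HMFTwoRoot

variable {V : Type*} {E : Type*} [Fintype E] [DecidableEq E] [Fintype V] [DecidableEq V]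
  {R : Type*} [Field R] [LinearOrder R] [IsStrictOrderedRing R]

/-! ## Masses of the star -/

section Masses

variable (p : E → R) (ends : E → Sym2 V) {f₁ f₂ : E} {a₃ a₁ a₂ : V}

omit [Fintype V] [DecidableEq V] [LinearOrder R] [IsStrictOrderedRing R] in
/-- A free event keeps its probability with `f` pinned closed. -/
lemma prob_update_zero_of_free {f : E} {A : Set (Config E)} (hA : Free f A) :
    prob (Function.update p f 0) A = prob p A := by
  rw [prob_eq_expect_indicator, prob_eq_expect_indicator, expect_update_zero]
  unfold expect
  refine Finset.sum_congr rfl fun ω _ => ?_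
  dsimp only
  congr 1
  have hiff : Function.update ω f false ∈ A ↔ ω ∈ A :=
    dependsOn_mem_iff hA fun e he => Function.update_of_ne he _ _
  by_cases h : ω ∈ A
  · rw [Set.indicator_of_mem h, Set.indicator_of_mem (hiff.2 h)]
    rfl
  · rw [Set.indicator_of_notMem h, Set.indicator_of_notMem (fun h' => h (hiff.1 h'))]

omit [Fintype E] [DecidableEq E] [Fintype V] [DecidableEq V] [LinearOrder R] [IsStrictOrderedRing R] in
/-- A star-free event is free of each star edge. -/
lemma free_of_star {A : Set (Config E)} (hA : DependsOn (· ∈ A) ({f₁, f₂}ᶜ : Set E)) :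
    Free f₁ A ∧ Free f₂ A := by
  constructor
  · intro ω ω' h
    exact hA fun e he => h e fun h' => he (Set.mem_insert_iff.2 (Or.inl (Set.mem_singleton_iff.1 h')))
  · intro ω ω' h
    exact hA fun e he => h e fun h' => he (Set.mem_insert_iff.2 (Or.inr h'))

omit [Fintype E] [DecidableEq E] [Fintype V] [DecidableEq V] [LinearOrder R] [IsStrictOrderedRing R] in
/-- The two star edges are distinct when the roots are. -/
lemma star_ne (hf₁ : ends f₁ = s(a₃, a₁)) (hf₂ : ends f₂ = s(a₃, a₂)) (h12 : a₁ ≠ a₂) : f₁ ≠ f₂ := by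
  rintro rfl
  rw [hf₁] at hf₂
  rcases Sym2.eq_iff.1 hf₂ with ⟨_, h⟩ | ⟨h, h'⟩
  · exact h12 h
  · exact h12 (h'.trans h)

omit [Fintype E] [DecidableEq E] [Fintype V] [DecidableEq V] [LinearOrder R] [IsStrictOrderedRing R] in
/-- An edge event at `f₂` is free of `f₁ ≠ f₂`. -/
lemma free_openEdge_of_ne (h : f₁ ≠ f₂) : Free f₁ (openEdge f₂) := by
  intro ω ω' hω
  show (ω f₂ = true) = (ω' f₂ = true)
  rw [hω f₂ (Ne.symm h)]

omit [Fintype E] [DecidableEq E] [Fintype V] [DecidableEq V] [LinearOrder R] [IsStrictOrderedRing R] in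
/-- An edge event at `f₂` is free of `f₁ ≠ f₂`. -/
lemma free_closedEdge_of_ne (h : f₁ ≠ f₂) : Free f₁ (closedEdge f₂) := by
  intro ω ω' hω
  show (ω f₂ = false) = (ω' f₂ = false)
  rw [hω f₂ (Ne.symm h)]

omit [Fintype V] [DecidableEq V] [LinearOrder R] [IsStrictOrderedRing R] in
/-- `P(A ∩ {f₁ closed} ∩ {f₂ closed}) = (1 − α)(1 − β) P(A)` for a star-free `A`. -/
lemma prob_inter_cc (h12 : f₁ ≠ f₂) {A : Set (Config E)}
    (hA : DependsOn (· ∈ A) ({f₁, f₂}ᶜ : Set E)) :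
    prob p (A ∩ (closedEdge f₁ ∩ closedEdge f₂)) = (1 - p f₁) * (1 - p f₂) * prob p A := by
  obtain ⟨h1, h2⟩ := free_of_star (f₁ := f₁) (f₂ := f₂) hA
  rw [← Set.inter_assoc, Set.inter_right_comm, prob_inter_closedEdge_of_free p
    (h1.inter (free_closedEdge_of_ne h12)), prob_inter_closedEdge_of_free p h2]
  ring

omit [Fintype V] [DecidableEq V] [LinearOrder R] [IsStrictOrderedRing R] in
/-- `P(A ∩ {f₁ closed} ∩ {f₂ open}) = (1 − α) β P(A)` for a star-free `A`. -/
lemma prob_inter_co (h12 : f₁ ≠ f₂) {A : Set (Config E)}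
    (hA : DependsOn (· ∈ A) ({f₁, f₂}ᶜ : Set E)) :
    prob p (A ∩ (closedEdge f₁ ∩ openEdge f₂)) = (1 - p f₁) * p f₂ * prob p A := by
  obtain ⟨h1, h2⟩ := free_of_star (f₁ := f₁) (f₂ := f₂) hA
  rw [← Set.inter_assoc, Set.inter_right_comm, prob_inter_closedEdge_of_free p
    (h1.inter (free_openEdge_of_ne h12)), prob_inter_openEdge_of_free p h2]
  ring

omit [Fintype V] [DecidableEq V] [LinearOrder R] [IsStrictOrderedRing R] in
/-- `P(A ∩ {f₁ open} ∩ {f₂ closed}) = α (1 − β) P(A)` for a star-free `A`. -/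
lemma prob_inter_oc (h12 : f₁ ≠ f₂) {A : Set (Config E)}
    (hA : DependsOn (· ∈ A) ({f₁, f₂}ᶜ : Set E)) :
    prob p (A ∩ (openEdge f₁ ∩ closedEdge f₂)) = p f₁ * (1 - p f₂) * prob p A := by
  obtain ⟨h1, h2⟩ := free_of_star (f₁ := f₁) (f₂ := f₂) hA
  rw [← Set.inter_assoc, Set.inter_right_comm, prob_inter_openEdge_of_free p
    (h1.inter (free_closedEdge_of_ne h12)), prob_inter_closedEdge_of_free p h2]
  ring

omit [Fintype V] [DecidableEq V] [LinearOrder R] [IsStrictOrderedRing R] in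
/-- `P(A ∩ {f₁ open} ∩ {f₂ open}) = α β P(A)` for a star-free `A`. -/
lemma prob_inter_oo (h12 : f₁ ≠ f₂) {A : Set (Config E)}
    (hA : DependsOn (· ∈ A) ({f₁, f₂}ᶜ : Set E)) :
    prob p (A ∩ (openEdge f₁ ∩ openEdge f₂)) = p f₁ * p f₂ * prob p A := by
  obtain ⟨h1, h2⟩ := free_of_star (f₁ := f₁) (f₂ := f₂) hA
  rw [← Set.inter_assoc, Set.inter_right_comm, prob_inter_openEdge_of_free p
    (h1.inter (free_openEdge_of_ne h12)), prob_inter_openEdge_of_free p h2]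
  ring

omit [Fintype V] [DecidableEq V] [LinearOrder R] [IsStrictOrderedRing R] in
/-- `P(A ∩ {not both open}) = (1 − αβ) P(A)` for a star-free `A`. -/
lemma prob_inter_nb (h12 : f₁ ≠ f₂) {A : Set (Config E)}
    (hA : DependsOn (· ∈ A) ({f₁, f₂}ᶜ : Set E)) :
    prob p (A ∩ (closedEdge f₁ ∪ closedEdge f₂)) = (1 - p f₁ * p f₂) * prob p A := by
  have hc : closedEdge f₁ ∪ closedEdge f₂ = (openEdge f₁ ∩ openEdge f₂)ᶜ := by
    rw [Set.compl_inter, closedEdge_eq_compl, closedEdge_eq_compl]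
  rw [hc]
  have h := prob_inter_add_prob_inter_compl p A (openEdge f₁ ∩ openEdge f₂)
  rw [prob_inter_oo p h12 hA] at h
  linear_combination h

end Masses

/-! ## The split of the mean-field sum at the star -/

section Split

variable (p : E → R) (ends : E → Sym2 V) {f₁ f₂ : E} {a₃ a₁ a₂ : V}

omit [Fintype E] [Fintype V] [DecidableEq V] [LinearOrder R] [IsStrictOrderedRing R] in
/-- `{C(a₃) = W} ∩ {both closed}` is `{both closed}` if `W = {a₃}` and empty otherwise. -/
lemma clusterEvent_a3_inter_cc (hstar : ∀ e, a₃ ∈ ends e → e = f₁ ∨ e = f₂) (W : Set V) :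
    clusterEvent ends a₃ W ∩ (closedEdge f₁ ∩ closedEdge f₂) =
      if W = {a₃} then closedEdge f₁ ∩ closedEdge f₂ else ∅ := by
  ext ω
  simp only [Set.mem_inter_iff, mem_clusterEvent, mem_closedEdge]
  split_ifs with hW
  · subst hW
    constructor
    · rintro ⟨_, h⟩; exact h
    · intro h; exact ⟨cluster_a3_closed (f₁ := f₁) (f₂ := f₂) hstar h.1 h.2, h⟩
  · simp only [Set.mem_empty_iff_false, iff_false, not_and]
    intro h h1 h2
    exact hW (h ▸ cluster_a3_closed (f₁ := f₁) (f₂ := f₂) hstar h1 h2)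

omit [Fintype E] [DecidableEq E] [Fintype V] [DecidableEq V] [LinearOrder R] [IsStrictOrderedRing R] in
/-- With `f₂` open the cluster of `a₃` is the cluster of `a₂`. -/
lemma clusterEvent_a3_inter_open₂ (hf₂ : ends f₂ = s(a₃, a₂)) (W : Set V) (B : Set (Config E))
    (hB : ∀ ω ∈ B, ω f₂ = true) :
    clusterEvent ends a₃ W ∩ B = clusterEvent ends a₂ W ∩ B := by
  ext ω
  simp only [Set.mem_inter_iff, mem_clusterEvent]
  constructor
  · rintro ⟨h, hω⟩; exact ⟨(cluster_a3_open₂ hf₂ (hB ω hω)).symm.trans h, hω⟩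
  · rintro ⟨h, hω⟩; exact ⟨(cluster_a3_open₂ hf₂ (hB ω hω)).trans h, hω⟩

omit [Fintype E] [DecidableEq E] [Fintype V] [DecidableEq V] [LinearOrder R] [IsStrictOrderedRing R] in
/-- With `f₁` open the cluster of `a₃` is the cluster of `a₁`. -/
lemma clusterEvent_a3_inter_open₁ (hf₁ : ends f₁ = s(a₃, a₁)) (W : Set V) (B : Set (Config E))
    (hB : ∀ ω ∈ B, ω f₁ = true) :
    clusterEvent ends a₃ W ∩ B = clusterEvent ends a₁ W ∩ B := by
  ext ω
  simp only [Set.mem_inter_iff, mem_clusterEvent]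
  constructor
  · rintro ⟨h, hω⟩; exact ⟨(cluster_a3_open₁ hf₁ (hB ω hω)).symm.trans h, hω⟩
  · rintro ⟨h, hω⟩; exact ⟨(cluster_a3_open₁ hf₁ (hB ω hω)).trans h, hω⟩

omit [LinearOrder R] [IsStrictOrderedRing R] in
/-- The both-open rows carry no mean-field weight: either the cluster misses a root (probability
`0`) or it contains both roots (`termW = 0`). -/
lemma sum_oo_eq_zero (hf₁ : ends f₁ = s(a₃, a₁)) (hf₂ : ends f₂ = s(a₃, a₂)) (o b : V) :
    ∑ W : Finset V, prob p (clusterEvent ends a₁ (↑W : Set V) ∩ (openEdge f₁ ∩ openEdge f₂)) *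
      termW p ends o a₁ a₂ b W = 0 := by
  refine Finset.sum_eq_zero fun W _ => ?_
  by_cases h12 : a₁ ∈ W ∧ a₂ ∈ W
  · simp [termW, h12.1, h12.2]
  · have hempty : clusterEvent ends a₁ (↑W : Set V) ∩ (openEdge f₁ ∩ openEdge f₂) = ∅ := by
      ext ω
      simp only [Set.mem_inter_iff, mem_clusterEvent, mem_openEdge, Set.mem_empty_iff_false,
        iff_false, not_and]
      intro h h1 h2
      apply h12
      have e1 : a₁ ∈ cluster ends ω a₁ := mem_cluster_self ends ω a₁
      have e2 : a₂ ∈ cluster ends ω a₁ :=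
        conn_trans (conn_symm (conn_of_openAdj ⟨f₁, h1, hf₁⟩)) (conn_of_openAdj ⟨f₂, h2, hf₂⟩)
      rw [h] at e1 e2
      exact ⟨Finset.mem_coe.1 e1, Finset.mem_coe.1 e2⟩
    rw [hempty, prob_empty, zero_mul]

omit [LinearOrder R] [IsStrictOrderedRing R] in
/-- **The split of `X̂` at the star**: the `{a₃}` row, the heavy rows (`f₁` closed, `f₂` open) and the
light rows (`f₁` open, `f₂` closed). -/
lemma Xhat_star (hf₁ : ends f₁ = s(a₃, a₁)) (hf₂ : ends f₂ = s(a₃, a₂))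
    (hstar : ∀ e, a₃ ∈ ends e → e = f₁ ∨ e = f₂) (h12 : f₁ ≠ f₂) (o b : V) :
    Xhat p ends o a₁ a₂ a₃ b =
      (1 - p f₁) * (1 - p f₂) * termW p ends o a₁ a₂ b {a₃} +
        ∑ W : Finset V, prob p (clusterEvent ends a₂ (↑W : Set V) ∩ (closedEdge f₁ ∩ openEdge f₂)) *
          termW p ends o a₁ a₂ b W +
        ∑ W : Finset V, prob p (clusterEvent ends a₁ (↑W : Set V) ∩ (openEdge f₁ ∩ closedEdge f₂)) *
          termW p ends o a₁ a₂ b W := by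
  rw [Xhat_eq_sum]
  have hsplit : ∀ W : Finset V, prob p (clusterEvent ends a₃ (↑W : Set V)) =
      (if (↑W : Set V) = {a₃} then prob p (closedEdge f₁ ∩ closedEdge f₂) else 0) +
      prob p (clusterEvent ends a₂ (↑W : Set V) ∩ (closedEdge f₁ ∩ openEdge f₂)) +
      prob p (clusterEvent ends a₁ (↑W : Set V) ∩ (openEdge f₁ ∩ closedEdge f₂)) +
      prob p (clusterEvent ends a₁ (↑W : Set V) ∩ (openEdge f₁ ∩ openEdge f₂)) := by
    intro W
    have h1 := prob_inter_add_prob_inter_compl p (clusterEvent ends a₃ (↑W : Set V)) (openEdge f₁)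
    have h2 := prob_inter_add_prob_inter_compl p
      (clusterEvent ends a₃ (↑W : Set V) ∩ closedEdge f₁) (openEdge f₂)
    have h3 := prob_inter_add_prob_inter_compl p
      (clusterEvent ends a₃ (↑W : Set V) ∩ openEdge f₁) (openEdge f₂)
    rw [← closedEdge_eq_compl] at h1 h2 h3
    rw [Set.inter_assoc, Set.inter_assoc] at h2 h3
    rw [clusterEvent_a3_inter_cc ends hstar,
      clusterEvent_a3_inter_open₂ ends hf₂ _ _ (fun ω hω => hω.2)] at h2
    rw [clusterEvent_a3_inter_open₁ ends hf₁ _ _ (fun ω hω => hω.1),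
      clusterEvent_a3_inter_open₁ ends hf₁ _ _ (fun ω hω => hω.1)] at h3
    have e : (if (↑W : Set V) = {a₃} then prob p (closedEdge f₁ ∩ closedEdge f₂) else 0) =
        prob p (if (↑W : Set V) = {a₃} then closedEdge f₁ ∩ closedEdge f₂ else ∅) := by
      split_ifs <;> simp
    rw [e]
    linear_combination -h1 - h2 - h3
  simp only [hsplit, add_mul, Finset.sum_add_distrib]
  rw [sum_oo_eq_zero p ends hf₁ hf₂ o b, add_zero]
  congr 2
  rw [Finset.sum_eq_single ({a₃} : Finset V)]
  · have hcc : prob p (closedEdge f₁ ∩ closedEdge f₂) = (1 - p f₁) * (1 - p f₂) := by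
      have := prob_inter_cc p h12 (A := Set.univ) (by intro ω ω' _; rfl)
      rwa [Set.univ_inter, prob_univ, mul_one] at this
    simp [hcc]
  · intro W _ hW
    have : (↑W : Set V) ≠ {a₃} := by
      intro h
      apply hW
      rw [← Finset.coe_singleton] at h
      exact Finset.coe_injective h
    simp [this]
  · intro h
    exact absurd (Finset.mem_univ _) h

end Split

/-! ## The heavy and light rows as pinned expectations -/

section Rows

variable (p : E → R) (ends : E → Sym2 V) {f₁ f₂ : E} {a₃ a₁ a₂ : V}

omit [LinearOrder R] [IsStrictOrderedRing R] in
/-- `termW` only sees probabilities of events off the explored cluster. -/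
lemma termW_congr {p' : E → R} {W : Finset V} (o a₁ a₂ b : V)
    (h : ∀ A : Set (Config E), DependsOn (· ∈ A) (touches ends ↑W)ᶜ → prob p' A = prob p A) :
    termW p' ends o a₁ a₂ b W = termW p ends o a₁ a₂ b W := by
  have hc : ∀ x v, prob p' (connDelEvent ends W x v) = prob p (connDelEvent ends W x v) :=
    fun x v => h _ (dependsOn_connDelEvent ends W x v)
  have hQ : prob p' (delQ ends W a₁ a₂) = prob p (delQ ends W a₁ a₂) :=
    h _ (dependsOn_compl (dependsOn_connDelEvent ends W a₁ a₂))
  have hQc : ∀ x v, prob p' (delQ ends W a₁ a₂ ∩ connDelEvent ends W x v) =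
      prob p (delQ ends W a₁ a₂ ∩ connDelEvent ends W x v) := fun x v => by
    refine h _ ?_
    have := dependsOn_inter (dependsOn_compl (dependsOn_connDelEvent ends W a₁ a₂))
      (dependsOn_connDelEvent ends W x v)
    rwa [Set.union_self] at this
  unfold termW termT termPD delConnProb delShareMass
  simp only [hc, hQ, hQc]

omit [LinearOrder R] [IsStrictOrderedRing R] in
/-- Pinning an edge that touches `W` closed does not change `termW`. -/
lemma termW_update_zero {f : E} {W : Finset V} (hfW : f ∈ touches ends (↑W : Set V))
    (o a₁ a₂ b : V) :
    termW (Function.update p f 0) ends o a₁ a₂ b W = termW p ends o a₁ a₂ b W :=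
  termW_congr p ends o a₁ a₂ b fun _ hA =>
    prob_update_zero_of_free p (HMFPendantRoot.free_of_dependsOn_touches_compl ends hfW hA)

omit [LinearOrder R] [IsStrictOrderedRing R] in
/-- `termW` is symmetric in the roots on a cluster containing `a₁`. -/
lemma termW_swap_of_mem {W : Finset V} (o a₁ a₂ b : V) (h1 : a₁ ∈ W) :
    termW p ends o a₁ a₂ b W = termW p ends o a₂ a₁ b W := by
  unfold termW
  by_cases h2 : a₂ ∈ W <;> simp [h1, h2]

omit [Fintype V] [DecidableEq V] [LinearOrder R] [IsStrictOrderedRing R] in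
/-- `E[1_{e closed} · H] = (1 − p e) · E_{p[e↦0]}[H]`. -/
lemma expect_indicator_closedEdge_mul (e : E) (H : Config E → R) :
    expect p (fun ω => (closedEdge e).indicator 1 ω * H ω) =
      (1 - p e) * expect (Function.update p e 0) H := by
  rw [expect_eq_pin p _ e]
  have h1 : expect (Function.update p e 1) (fun ω => (closedEdge e).indicator 1 ω * H ω) = 0 := by
    unfold expect
    refine Finset.sum_eq_zero fun ω _ => ?_
    dsimp only
    by_cases h : ω e = true
    · rw [Set.indicator_of_notMem (show ω ∉ closedEdge e by simp [h])]; ring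
    · simp only [Bool.not_eq_true] at h
      rw [weight_update_one_of_eq_false p h]; ring
  have h0 : expect (Function.update p e 0) (fun ω => (closedEdge e).indicator 1 ω * H ω) =
      expect (Function.update p e 0) H := by
    unfold expect
    refine Finset.sum_congr rfl fun ω _ => ?_
    dsimp only
    by_cases h : ω e = true
    · rw [weight_update_zero_of_eq_true p h]; ring
    · simp only [Bool.not_eq_true] at h
      rw [Set.indicator_of_mem (show ω ∈ closedEdge e by simpa using h)]
      simp
  rw [h1, h0]
  ring

omit [Fintype V] [DecidableEq V] [LinearOrder R] [IsStrictOrderedRing R] in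
/-- With `f₂` open, a cluster of `a₂` contains `a₃`. -/
lemma clusterEvent_a2_inter_open₂_empty (hf₂ : ends f₂ = s(a₃, a₂)) {W : Finset V} (h3 : a₃ ∉ W)
    (B : Set (Config E)) (hB : ∀ ω ∈ B, ω f₂ = true) :
    prob p (clusterEvent ends a₂ (↑W : Set V) ∩ B) = 0 := by
  have : clusterEvent ends a₂ (↑W : Set V) ∩ B = ∅ := by
    ext ω
    simp only [Set.mem_inter_iff, mem_clusterEvent, Set.mem_empty_iff_false, iff_false, not_and]
    intro h hω
    apply h3
    have : a₃ ∈ cluster ends ω a₂ := conn_symm (conn_of_openAdj ⟨f₂, hB ω hω, hf₂⟩)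
    rw [h] at this
    exact Finset.mem_coe.1 this
  rw [this, prob_empty]

omit [LinearOrder R] [IsStrictOrderedRing R] in
/-- **The heavy rows**: `Σ_W P(C(a₂) = W, f₁ closed, f₂ open) · termW(W) = (1 − α) β · E_h[Fheavy(C(a₂))]`
with `E_h` the expectation under `p[f₁ ↦ 0][f₂ ↦ 1]`. -/
lemma heavy_sum_star (hf₁ : ends f₁ = s(a₃, a₁)) (hf₂ : ends f₂ = s(a₃, a₂)) (h12 : f₁ ≠ f₂)
    (o b : V) :
    ∑ W : Finset V, prob p (clusterEvent ends a₂ (↑W : Set V) ∩ (closedEdge f₁ ∩ openEdge f₂)) *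
        termW p ends o a₁ a₂ b W =
      (1 - p f₁) * p f₂ * expect (Function.update (Function.update p f₁ 0) f₂ 1)
        (fun ω => HMFPendantRoot.Fheavy (Function.update p f₁ 0) ends f₂ o a₁ b (cluster ends ω a₂)) := by
  have hq : p f₂ = Function.update p f₁ 0 f₂ := (Function.update_of_ne (Ne.symm h12) _ _).symm
  rw [mul_assoc, hq, ← HMFPendantRoot.expect_indicator_openEdge_mul, ← expect_indicator_closedEdge_mul]
  have e : (fun ω => (closedEdge f₁).indicator (1 : Config E → R) ω * ((openEdge f₂).indicator 1 ω *
      HMFPendantRoot.Fheavy (Function.update p f₁ 0) ends f₂ o a₁ b (cluster ends ω a₂))) =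
      fun ω => (closedEdge f₁ ∩ openEdge f₂).indicator 1 ω *
        HMFPendantRoot.Fheavy (Function.update p f₁ 0) ends f₂ o a₁ b (cluster ends ω a₂) := by
    funext ω
    rw [Set.inter_indicator_one]
    simp only [Pi.mul_apply]
    ring
  rw [e, ← HMFPendantRoot.sum_prob_clusterEvent_inter_mul]
  refine Finset.sum_congr rfl fun W _ => ?_
  by_cases h3 : a₃ ∈ W
  · by_cases h2 : a₂ ∈ W
    · have hfW : f₁ ∈ touches ends (↑W : Set V) :=
        mem_touches_of_ends hf₁ (Or.inl (Finset.mem_coe.2 h3))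
      rw [← termW_update_zero p ends hfW o a₁ a₂ b,
        HMFPendantRoot.termW_eq_Fheavy (Function.update p f₁ 0) ends hf₂ o a₁ b h2]
    · have : clusterEvent ends a₂ (↑W : Set V) ∩ (closedEdge f₁ ∩ openEdge f₂) = ∅ := by
        ext ω
        simp only [Set.mem_inter_iff, mem_clusterEvent, Set.mem_empty_iff_false, iff_false, not_and]
        intro h
        exact absurd (Finset.mem_coe.1 (h ▸ mem_cluster_self ends ω a₂)) h2
      rw [this, prob_empty, zero_mul, zero_mul]
  · rw [clusterEvent_a2_inter_open₂_empty p ends hf₂ h3 _ (fun ω hω => hω.2), zero_mul, zero_mul]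

omit [LinearOrder R] [IsStrictOrderedRing R] in
/-- **The light rows** (the mirror of `heavy_sum_star`): the expectation under `p[f₂ ↦ 0][f₁ ↦ 1]`. -/
lemma light_sum_star (hf₁ : ends f₁ = s(a₃, a₁)) (hf₂ : ends f₂ = s(a₃, a₂)) (h12 : f₁ ≠ f₂)
    (o b : V) :
    ∑ W : Finset V, prob p (clusterEvent ends a₁ (↑W : Set V) ∩ (openEdge f₁ ∩ closedEdge f₂)) *
        termW p ends o a₁ a₂ b W =
      (1 - p f₂) * p f₁ * expect (Function.update (Function.update p f₂ 0) f₁ 1)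
        (fun ω => HMFPendantRoot.Fheavy (Function.update p f₂ 0) ends f₁ o a₂ b (cluster ends ω a₁)) := by
  rw [← heavy_sum_star p ends (f₁ := f₂) (f₂ := f₁) (a₃ := a₃) (a₁ := a₂) (a₂ := a₁) hf₂ hf₁
    (Ne.symm h12) o b]
  refine Finset.sum_congr rfl fun W _ => ?_
  rw [Set.inter_comm (openEdge f₁) (closedEdge f₂)]
  by_cases h1 : a₁ ∈ W
  · rw [termW_swap_of_mem p ends o a₁ a₂ b h1]
  · have : clusterEvent ends a₁ (↑W : Set V) ∩ (closedEdge f₂ ∩ openEdge f₁) = ∅ := by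
      ext ω
      simp only [Set.mem_inter_iff, mem_clusterEvent, Set.mem_empty_iff_false, iff_false, not_and]
      intro h
      exact absurd (Finset.mem_coe.1 (h ▸ mem_cluster_self ends ω a₁)) h1
    rw [this, prob_empty, zero_mul, zero_mul]

end Rows

end HMFTwoRoot

end Summit.Ventures.PercRepro2
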